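import Literature.MathematicalPhysics.QuantumFieldTheory.Balaban1983to89.T4SmallFieldWindowSandwich
import Literature.MathematicalPhysics.QuantumFieldTheory.Balaban1983to89.Node00.BackgroundSelOfRecord
import HarnessLib

/-!
# DAG node N07 [B11] — Sect. F (147) ∕ (160) case I AT THE RECORD, road-independent half of «BRIDGE-92»: the constraint DATA of the (0.21)
# problem of record re-gauged by the COARSE axial gauge of a top cube, the minimiser following by [B11] (181), and the re-gauged data bond-small
# on the cube — by name from pv26's torus Poincaré lemma and node00-def-B's ∕ dag-n09-w2's transport of minimisers (module 40 of the n07-e lineage)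

Cell `pub-ymgap` (HUMAN RULINGS D-0062 ∕ D-0088), seat `pub-ymgap-dag-n07-e` g19 (R141 (C) row s3 lineage), 2026-08-28.  `--kind proof --supports
stmt-QuantumFields-20541 --as helper` (K0⁷; count-neutral helper for the S6 head of V19 stub 1 `stub_prop8StepCoP13`).

THE PRINT ([B11] = T. Bałaban, *The variational problem and background fields in renormalization group method for lattice gauge theories*, Commun.
Math. Phys. **102** (1985) 277–309 `[Balaban1985Variational]`, Sect. F pp. 300–303, pages 301–302 READ AS IMAGES
`run/shared/lean/pub/pub-balaban/b2b-balaban-ref1/pages/1985-cmp102-variational-background/…-p025∕p026-x2.png`):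
* p. 301 (147): «the gauge transformation changing U_k into U′_k does not belong to the subgroup (4) leaving the space (3) invariant. In fact the configuration V
  defining this space is changed into a configuration V′ … if we define V′₁ as V′₁ = V̄′ on □′_k^{(k)}, V′₁ = V′ on □″_k^{(k)}, (147) then V′₁ satisfies the
  generalized axial gauge conditions on □_k^{(k)} with a center at the point y.»
* p. 303, the first case of (160): «It satisfies the generalized axial gauge conditions on □̃_k^{(k)} with a center at the point y, hence |V′₁(x, x′) − 1| <
  |x − y|2L²ε₁ for ⟨x, x′⟩ ⊂ □̃_k^{(k)} … Thus the above estimate implies that |B(x, x′)| < |x − y|4L²ε₁.»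
* p. 307 (181) (the covariance of the minimiser, typed at the record by node00-def-B as `Node00.UkSel_gaugeAct_blockLift`).

WHAT THIS FILE DOES (kernel bookkeeping over landed theorems; NO estimate of [B11] ∕ [6] ∕ [3] is proved or asserted).  At the record — torus family `F`,
`SU(N)`, the averaging of record `Node00.avOfRecord` ((0.4), point-covariant at block centres: `Setup.Averaging.covariant`), the (0.21) class `Node00.bgReg` and
problem `Node00.UkExists` ∕ `Node00.UkSel` — and for a NON-WRAPPING box `[lo, hi]` of the TOP lattice `T^{(k)}` (the top cube `□_k^{(k)}` of Sect. F):
* §1 `isBackground_gaugeAct_blockLift` — a minimiser `U₀` over `V` goes to the minimiser `U₀^{v̄}` over the RE-GAUGED DATA `V^{v}` (node00-def-B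
  `Node00.isBackground_gaugeAct_toMS'` at `u := blockLift k v`): print's sentence «V … is changed into a configuration V′» as an exact statement about the
  record's (0.21) problem — for EVERY coarse gauge transformation `v`, no smallness (`M^k(U^{v̄}) = (M^k U)^{v}` is r13's `B16Sect1Backgrounds.iter_gaugeAct` at
  r15's `toMS_blockLift_self`; as a named lemma it is dag-n09-w3's `N09AxialSelectionExists.iter_gaugeAct_blockLift`, not restated); `ukExists_gaugeAct_iff_record`.
* §2 the (147) PACKAGE at the data's coarse axial gauge `h := T4AxialGaugeSmallField.axialGauge V lo hi` (pv26; rooted at the corner `lo` — print roots at the centre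
  `y`; the distance count below is from the root either way): ★ `isBackground_dataAxial` (§1 at `h`), ★ `UkSel_dataAxial` (`UkSel (V^h) = (UkSel V)^{h̄}` on the [B11]
  domain, = `Node00.UkSel_gaugeAct_blockLift`), ★★ `dist1_dataAxial_le` (if the data's plaquettes on the box are `< δ` — print's (7) for `V` — then EVERY box bond of
  `V^h` has `dist1 ≤ (d − 1)·n·δ`, `n + 1` sites per direction, `n < sitesPerDir k`; = pv26 `dist1_gaugeAct_axialGauge_le_of_mem_boxBonds`), ★★ `dist1_dataAxial_le_sharp` (the distance-weighted
  form `≤ (Σ_{κ<μ}|x_κ − lo_κ|)·δ`, print's «|x − y|·…» shape, = pv26 `dist1_gaugeAct_axialGauge_le`), `dataAxial_treeBond_eq_one`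
  (tree bonds are exactly `1`), and the one-binder form ★★★ `exists_dataAxial_topBox`.
* §3 the (160) CASE-I SHAPE for any log-like datum: for `β : SU(N) → E` into a seminormed group with `‖β g‖ ≤ C·dist1 g` on `dist1 g ≤ r` (the principal logarithm
  `(1∕i) log` has `C = 2` on `dist1 ≤ ½`, `MatrixLog.norm_mlog_le_two_mul` ∕ `B11Eq160BondField.norm_fieldB_le` — not re-derived here), the datum `B b := β (V^h b)` obeys
  ★★ `norm_datum_dataAxial_le` `‖B b‖ ≤ C·(d − 1)·n·δ` on the box bonds once `(d − 1)·n·δ ≤ r`, and the CENTRED weakening ★ `norm_datum_dataAxial_le_centred`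
  `‖B b‖ ≤ (C(d − 1)nδ)·(t + 1)` for every `t ≥ 0` — the hypothesis shape `‖B c‖ ≤ β·(dist + 1)` of dag-n07-w4's `near_of_centred_box` (INTENT-9, bus I.28710).
* §4 NON-VACUITY: at the unit data `V = 1` every hypothesis is met (`exists_dataAxial_topBox_one`, via pv26's `T4SmallFieldWindowSandwich.plaqSmallOn_one`).

HONEST FRAMING (binding).  Count-neutral helper; by-name composition; nothing of [B11] Sect. F's analysis is asserted.  NOT done here, and located in the
lineage's `STUB1-SECTF-MAP.md` § BRIDGE-92 ∕ § BRIDGE-92-B: (a) the second case of (160) (bonds crossing `∂□″`, Lemma 1 of [6]) and the far-field (155); (b) the Landau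
re-gauging `u` of [6] Thm 2 and the resulting SHEAR of the record's data (`M^j(U′^{u⁻¹}) = (u∘emb)⁻¹·V″·(u∘emb)`, GAP-STATED(avg-universality)); (c) which road consumes
the datum `β ∘ V^h` is the planners' word.  The block-constant lift `blockLift k h` is the EXACT transport of the (0.21) problem; print's fine-level axial gauge of `U_k`
(a different, smooth representative of the same residual orbit) is not constructed here.  Tokens ∕ stub 1 ∕ K0⁷ NOT closed; N07 NOT discharged (5∕27 unmoved); one
finite `T⁴` programme at fixed `ε`, Bałaban AS PRINTED — R4 closes rung `BalabanLadder.UV` only; NOT continuum ∕ ℝ⁴ ∕ OS ∕ mass gap ∕ Clay.  No `sorry`, no `def`,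
no `instance`, no `notation`.
-/

noncomputable section

namespace Summit.QuantumFields.YangMills.BalabanUVNodes.N07DataAxialTopBox

open Literature.MathematicalPhysics.QuantumFieldTheory.Balaban1983to89
open Node00 (avOfRecord bgReg UkExists UniqueUkOrbit UkSel isBackground_gaugeAct_toMS' ukExists_gaugeAct_iff' UkSel_gaugeAct_blockLift)
open B15Eq177GaugeInvariance (blockLift toMS_blockLift_self)
open B16Sect1Backgrounds (toMS iter_gaugeAct)
open T4AxialGaugeSmallField (axialGauge boxPlaqs boxBonds castSite dist1_gaugeAct_axialGauge_le dist1_gaugeAct_axialGauge_le_of_mem_boxBonds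
  gaugeAct_axialGauge_eq_one)
open B7Prop1Explicit (e l1)
open B8Lemma1NonAbelian (lowPart)
open GaugeField (gaugeAct)
open T4Continuum (T4Family)

/-! ## §1  «the configuration V defining this space is changed into a configuration V′» — transport of the (0.21) minimisers of record under a COARSE gauge -/

section Record

variable {F : T4Family} {N : ℕ} [NeZero N] {K k : ℕ} {ε : ℝ}

/-- **(147)'s bookkeeping at the record, for EVERY coarse gauge transformation `v` of `T^{(k)}`**: if `U₀` minimises the Wilson action on `{M^k(U) = V}` within
the class `bgReg` of record, then its gauge copy `U₀^{v̄}`, `v̄ = blockLift k v`, minimises it on `{M^k(U) = V^{v}}` — node00-def-B's `isBackground_gaugeAct_toMS'`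
(dag-n09-w2's `isBackground_gaugeAct_toMS`, [I] (0.21) p. 256) at the block-constant lift, `v̄↾T^{(k)} = v`. [cite: Balaban1985Variational, (147) p.301, (181) p.307] -/
theorem isBackground_gaugeAct_blockLift (hk : k ≤ (F.P K).m + (F.P K).K) {V : GaugeField (F.P K) k (Node00.SU N)}
    {U₀ : GaugeField (F.P K) 0 (Node00.SU N)} (h : IsBackground (avOfRecord F N K) (bgReg F N K k ε) k V U₀)
    (v : GaugeTransf (F.P K) k (Node00.SU N)) :
    IsBackground (avOfRecord F N K) (bgReg F N K k ε) k (gaugeAct v V) (gaugeAct (blockLift k v) U₀) := by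
  have h' := isBackground_gaugeAct_toMS' (ε := ε) hk h (blockLift k v)
  rwa [toMS_blockLift_self hk] at h'

/-- Solvability of the (0.21) problem of record is unchanged by re-gauging the data (node00-def-B's `ukExists_gaugeAct_iff'`, recorded for the package below).
[cite: Balaban1987RG1, (0.21) p.256] -/
theorem ukExists_gaugeAct_iff_record (hk : k ≤ (F.P K).m + (F.P K).K) (v : GaugeTransf (F.P K) k (Node00.SU N))
    (V : GaugeField (F.P K) k (Node00.SU N)) : UkExists F N K k ε (gaugeAct v V) ↔ UkExists F N K k ε V :=
  ukExists_gaugeAct_iff' hk v V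

/-! ## §2  The (147) package at the COARSE AXIAL GAUGE of the data on a non-wrapping top box -/

/-- ★ **(147) at the record, minimiser side**: with `h := axialGauge V lo hi` the coarse axial gauge of the DATA on the box (pv26), every minimiser `U₀` over `V`
gives the minimiser `U₀^{h̄}` over the axially re-gauged data `V^h`. [cite: Balaban1985Variational, (147) p.301] -/
theorem isBackground_dataAxial (hk : k ≤ (F.P K).m + (F.P K).K) {V : GaugeField (F.P K) k (Node00.SU N)} {U₀ : GaugeField (F.P K) 0 (Node00.SU N)}
    (h : IsBackground (avOfRecord F N K) (bgReg F N K k ε) k V U₀) (lo hi : Fin (F.P K).d → ℤ) :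
    IsBackground (avOfRecord F N K) (bgReg F N K k ε) k (gaugeAct (axialGauge V lo hi) V) (gaugeAct (blockLift k (axialGauge V lo hi)) U₀) :=
  isBackground_gaugeAct_blockLift hk h _

/-- ★ **(147) at the record, selector side ([B11] (181) by name)**: on the [B11] domain — (0.21) solvable at `V`, the minimal orbit over `V^h` unique — the minimiser
OF RECORD of the axially re-gauged data is the lifted gauge copy: `UkSel (V^h) = (UkSel V)^{h̄}` (node00-def-B's `UkSel_gaugeAct_blockLift`; the uniqueness binder is
gauge invariant by dag-n09-w2's `uniqueUkOrbit_gaugeAct_iff`, not imported here). [cite: Balaban1985Variational, (181) p.307] -/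
theorem UkSel_dataAxial (hk : k ≤ (F.P K).m + (F.P K).K) {V : GaugeField (F.P K) k (Node00.SU N)} (lo hi : Fin (F.P K).d → ℤ)
    (hV : UkExists F N K k ε V) (hu : UniqueUkOrbit F N K k ε (gaugeAct (axialGauge V lo hi) V)) :
    UkSel F N K k ε (gaugeAct (axialGauge V lo hi) V) = gaugeAct (blockLift k (axialGauge V lo hi)) (UkSel F N K k ε V) :=
  UkSel_gaugeAct_blockLift hk _ hV hu

/-- ★★ **(160), first case, at the record — the re-gauged DATA is bond-small on the box**: if the data's plaquettes based in the box are `< δ` (print's (7) for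
`V`, `0 ≤ δ`), the box has `n + 1` sites per direction and does not wrap (`n < sitesPerDir k`), then every box bond `b` of `V^h` has `dist1 (V^h b) ≤ (d − 1)·n·δ`
(pv26's torus non-abelian Poincaré lemma `dist1_gaugeAct_axialGauge_le_of_mem_boxBonds`; print: «|V′₁(x, x′) − 1| < |x − y|2L²ε₁»). [cite: Balaban1985Variational, (160) p.303] -/
theorem dist1_dataAxial_le (V : GaugeField (F.P K) k (Node00.SU N)) {lo hi : Fin (F.P K).d → ℤ} {δ : ℝ} {S₀ : Set (Plaq (F.P K) k)}
    {n : ℕ} (hS₀ : boxPlaqs lo hi ⊆ S₀) (hU : PlaqSmallOn S₀ δ V) (hδ : 0 ≤ δ) (hn : ∀ κ, hi κ ≤ lo κ + n)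
    (hnN : n < (F.P K).sitesPerDir k) {b : PBond (F.P K) k} (hb : b ∈ boxBonds lo hi) :
    dist1 (gaugeAct (axialGauge V lo hi) V b) ≤ (((F.P K).d - 1 : ℕ) : ℝ) * n * δ :=
  dist1_gaugeAct_axialGauge_le_of_mem_boxBonds V hS₀ hU hδ hn hnN hb

/-- ★★ **(160), first case, SHARP (distance-weighted) form** — print's «|V′₁(x, x′) − 1| < |x − y|·2L²ε₁» with the distance read from the root: on a
non-wrapping box, the bond `⟨x, x + e_μ⟩` of `V^h` has `dist1 ≤ (Σ_{κ<μ}|x_κ − lo_κ|)·δ ≤ (Σ_κ |x_κ − lo_κ|)·δ` — pv26's `dist1_gaugeAct_axialGauge_le` (sharp tree-gauge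
count; the second inequality is `B8Lemma1NonAbelian.lowPart_le_self`, left to the consumer). [cite: Balaban1985Variational, (160) p.303] -/
theorem dist1_dataAxial_le_sharp (V : GaugeField (F.P K) k (Node00.SU N)) {lo hi : Fin (F.P K).d → ℤ} {δ : ℝ} {S₀ : Set (Plaq (F.P K) k)}
    (hS₀ : boxPlaqs lo hi ⊆ S₀) (hU : PlaqSmallOn S₀ δ V) (hN : ∀ κ, hi κ - lo κ < (F.P K).sitesPerDir k)
    {x : Fin (F.P K).d → ℤ} {μ : Fin (F.P K).d} (hx : lo ≤ x) (hxμ : x + e μ ≤ hi) :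
    dist1 (gaugeAct (axialGauge V lo hi) V ⟨castSite x, μ⟩) ≤ (l1 (lowPart μ (x - lo)) : ℝ) * δ :=
  dist1_gaugeAct_axialGauge_le V hS₀ hU hN hx hxμ

/-- The TREE bonds of the box are exactly `1` after the re-gauging (no smallness needed) — pv26's `gaugeAct_axialGauge_eq_one` (print: «V″(Γ_{x,x₁}) = 1 for
x₁ ∈ B(x)»). [cite: Balaban1985Variational, (160) p.303] -/
theorem dataAxial_treeBond_eq_one (V : GaugeField (F.P K) k (Node00.SU N)) {lo hi : Fin (F.P K).d → ℤ}
    (hN : ∀ κ, hi κ - lo κ < (F.P K).sitesPerDir k) {x : Fin (F.P K).d → ℤ} {μ : Fin (F.P K).d} (hx : lo ≤ x) (hxμ : x + e μ ≤ hi)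
    (htree : lowPart μ (x - lo) = 0) :
    gaugeAct (axialGauge V lo hi) V ⟨castSite x, μ⟩ = 1 :=
  gaugeAct_axialGauge_eq_one V hN hx hxμ htree

/-- ★★★ **THE (147) PACKAGE AT THE RECORD, one binder**: for data `V` whose plaquettes based in a non-wrapping top box are `< δ`, there is a coarse gauge
transformation `h` of `T^{(k)}` (the data's axial gauge on the box) such that (i) every minimiser over `V` is carried to a minimiser over `V^h` by the lifted copy
`U ↦ U^{h̄}`, (ii) solvability is unchanged, and (iii) every box bond of the re-gauged data has `dist1 ≤ (d − 1)·n·δ`. [cite: Balaban1985Variational, (147) p.301, (160) p.303] -/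
theorem exists_dataAxial_topBox (hk : k ≤ (F.P K).m + (F.P K).K) (V : GaugeField (F.P K) k (Node00.SU N)) {lo hi : Fin (F.P K).d → ℤ}
    {δ : ℝ} {S₀ : Set (Plaq (F.P K) k)} {n : ℕ} (hS₀ : boxPlaqs lo hi ⊆ S₀) (hU : PlaqSmallOn S₀ δ V) (hδ : 0 ≤ δ)
    (hn : ∀ κ, hi κ ≤ lo κ + n) (hnN : n < (F.P K).sitesPerDir k) :
    ∃ h : GaugeTransf (F.P K) k (Node00.SU N),
      (∀ U₀ : GaugeField (F.P K) 0 (Node00.SU N), IsBackground (avOfRecord F N K) (bgReg F N K k ε) k V U₀ →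
        IsBackground (avOfRecord F N K) (bgReg F N K k ε) k (gaugeAct h V) (gaugeAct (blockLift k h) U₀)) ∧
      (UkExists F N K k ε (gaugeAct h V) ↔ UkExists F N K k ε V) ∧
      ∀ b ∈ boxBonds lo hi, dist1 (gaugeAct h V b) ≤ (((F.P K).d - 1 : ℕ) : ℝ) * n * δ :=
  ⟨axialGauge V lo hi, fun _ h => isBackground_dataAxial hk h lo hi, ukExists_gaugeAct_iff_record hk _ V,
    fun _ hb => dist1_dataAxial_le V hS₀ hU hδ hn hnN hb⟩

/-! ## §3  The (160) case-I shape for a log-like datum, and the centred form the S6 head consumes -/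

/-- ★★ **(160), first case, for any LOG-LIKE datum**: if `β : SU(N) → E` satisfies `‖β g‖ ≤ C·dist1 g` whenever `dist1 g ≤ r` (the principal logarithm
`(1∕i) log` has `C = 2`, `r = ½`), and `(d − 1)·n·δ ≤ r`, then the datum `B b := β (V^h b)` of the axially re-gauged data obeys `‖B b‖ ≤ C·(d − 1)·n·δ` on every box
bond (print: «Thus the above estimate implies that |B(x, x′)| < |x − y|4L²ε₁»). [cite: Balaban1985Variational, (160) p.303] -/
theorem norm_datum_dataAxial_le {E : Type*} [SeminormedAddCommGroup E] (β : Node00.SU N → E) {C r : ℝ} (hC : 0 ≤ C)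
    (hβ : ∀ g : Node00.SU N, dist1 g ≤ r → ‖β g‖ ≤ C * dist1 g)
    (V : GaugeField (F.P K) k (Node00.SU N)) {lo hi : Fin (F.P K).d → ℤ} {δ : ℝ} {S₀ : Set (Plaq (F.P K) k)} {n : ℕ}
    (hS₀ : boxPlaqs lo hi ⊆ S₀) (hU : PlaqSmallOn S₀ δ V) (hδ : 0 ≤ δ) (hn : ∀ κ, hi κ ≤ lo κ + n) (hnN : n < (F.P K).sitesPerDir k)
    (hr : (((F.P K).d - 1 : ℕ) : ℝ) * n * δ ≤ r) {b : PBond (F.P K) k} (hb : b ∈ boxBonds lo hi) :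
    ‖β (gaugeAct (axialGauge V lo hi) V b)‖ ≤ C * ((((F.P K).d - 1 : ℕ) : ℝ) * n * δ) := by
  have hd := dist1_dataAxial_le V hS₀ hU hδ hn hnN hb
  exact (hβ _ (hd.trans hr)).trans (mul_le_mul_of_nonneg_left hd hC)

/-- ★ **The CENTRED form** (the hypothesis shape `‖B c‖ ≤ β·(dist + 1)` of dag-n07-w4's `near_of_centred_box`): a uniform bound is a centred bound with any
non-negative distance weight `t`. [cite: Balaban1985Variational, (160) p.303] -/
theorem norm_datum_dataAxial_le_centred {E : Type*} [SeminormedAddCommGroup E] (β : Node00.SU N → E) {C r : ℝ} (hC : 0 ≤ C)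
    (hβ : ∀ g : Node00.SU N, dist1 g ≤ r → ‖β g‖ ≤ C * dist1 g)
    (V : GaugeField (F.P K) k (Node00.SU N)) {lo hi : Fin (F.P K).d → ℤ} {δ : ℝ} {S₀ : Set (Plaq (F.P K) k)} {n : ℕ}
    (hS₀ : boxPlaqs lo hi ⊆ S₀) (hU : PlaqSmallOn S₀ δ V) (hδ : 0 ≤ δ) (hn : ∀ κ, hi κ ≤ lo κ + n) (hnN : n < (F.P K).sitesPerDir k)
    (hr : (((F.P K).d - 1 : ℕ) : ℝ) * n * δ ≤ r) {b : PBond (F.P K) k} (hb : b ∈ boxBonds lo hi) {t : ℝ} (ht : 0 ≤ t) :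
    ‖β (gaugeAct (axialGauge V lo hi) V b)‖ ≤ C * ((((F.P K).d - 1 : ℕ) : ℝ) * n * δ) * (t + 1) := by
  have h0 : 0 ≤ C * ((((F.P K).d - 1 : ℕ) : ℝ) * n * δ) := mul_nonneg hC (by positivity)
  calc ‖β (gaugeAct (axialGauge V lo hi) V b)‖ ≤ C * ((((F.P K).d - 1 : ℕ) : ℝ) * n * δ) :=
        norm_datum_dataAxial_le β hC hβ V hS₀ hU hδ hn hnN hr hb
    _ = C * ((((F.P K).d - 1 : ℕ) : ℝ) * n * δ) * 1 := (mul_one _).symm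
    _ ≤ C * ((((F.P K).d - 1 : ℕ) : ℝ) * n * δ) * (t + 1) := mul_le_mul_of_nonneg_left (by linarith) h0

/-! ## §4  Non-vacuity (A6 hygiene): the unit data meets every hypothesis -/

/-- NON-VACUITY of the package: at `V = 1`, `δ = 1` and any non-wrapping box the hypotheses of `exists_dataAxial_topBox` are met (the unit data is
plaquette-small for every positive threshold, pv26's `T4SmallFieldWindowSandwich.plaqSmallOn_one` BY NAME), so its conclusion is inhabited.
[cite: Balaban1985Variational, (147) p.301 (bookkeeping)] -/
theorem exists_dataAxial_topBox_one (hk : k ≤ (F.P K).m + (F.P K).K) {lo hi : Fin (F.P K).d → ℤ} {n : ℕ}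
    (hn : ∀ κ, hi κ ≤ lo κ + n) (hnN : n < (F.P K).sitesPerDir k) :
    ∃ h : GaugeTransf (F.P K) k (Node00.SU N),
      (∀ U₀ : GaugeField (F.P K) 0 (Node00.SU N), IsBackground (avOfRecord F N K) (bgReg F N K k ε) k 1 U₀ →
        IsBackground (avOfRecord F N K) (bgReg F N K k ε) k (gaugeAct h 1) (gaugeAct (blockLift k h) U₀)) ∧
      (UkExists F N K k ε (gaugeAct h 1) ↔ UkExists F N K k ε 1) ∧
      ∀ b ∈ boxBonds lo hi, dist1 (gaugeAct h (1 : GaugeField (F.P K) k (Node00.SU N)) b) ≤ (((F.P K).d - 1 : ℕ) : ℝ) * n * 1 :=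
  exists_dataAxial_topBox (ε := ε) hk 1 (S₀ := boxPlaqs lo hi) subset_rfl
    (T4SmallFieldWindowSandwich.plaqSmallOn_one _ one_pos) zero_le_one hn hnN

end Record

end Summit.QuantumFields.YangMills.BalabanUVNodes.N07DataAxialTopBox

end
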